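import Summits.HodgeConjecture.HodgeConjecture.Theorems.Ring2WeilCoverageNormCriteria
import Summits.HodgeConjecture.HodgeConjecture.Theorems.Ring2WeilCoverageNormTableC
import HarnessLib

/-!
# Weil-type family coverage — the row `W6.3.55 = (3, ℚ(√-3), a ≡ 55)` reached by TWO-ROW SPECHT windows (ring2-b02, gen 63)

research route conditional on HC_CM; not a corollary; Q11.4-sentence-2 already refuted in dim ≥ 3.

Ring 2, WEIL-TYPE FAMILY-COVERAGE CENSUS (`HOME/WEIL-FAMILY-COVERAGE.md` `## b02 (g = 6)`, block b02.23, owner ring2-b02).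
Gen 62's LEMMA DG confines every cyclic-carrier window on a NATURAL permutation module to the classes `[n]·⟨2,3⟩`; gen 63
replaces the natural module of `S_n` by the two-row Specht module `S^{(n-2,2)}` (LEMMA DG2: a twisted class `(ζ, y)` flips
`[2(n-1)(n-2)^{n-1}]·[n-2]^{c(y)}`, so the primes of `n - 1` AND `n - 2` enter).  For `n = 12` the module `S^{(10,2)}` (`d = 54`)
has `disc ≡ 2·11·10¹¹ ≡ [55]` over `ℚ(√-3)`, and the closed-form scan (`spechtwin.py`) + the direct engine (`direct4.py`) give
curve-carried `(3,3)` sixfolds on the hitherto EMPTY row `W6.3.55` (`T(55) = {5, 11}`):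
* `C₃ × S₁₂` on `S^{(10,2)}`, `(0; ω:3⁴, ω:3³2, ω:3³2)` (rigid, genus 239500801): Gram determinant `g₁₂ = 1/13365 = 1/(3⁵·5·11)`;
* `C₆ × S₁₂` on `S^{(10,2)}`, `(0; -1:2⁵1², ω:3³2·1, ζ₆:6²)` (rigid, genus 239500801): `g₁₃ = 1/30792960 = 1/(2⁸·3⁷·5·11)`;
both with `ℚ(√-3)`-signature `(3,3)` and THEOREM X's prediction `{5, 11}` AGREEING.  This file pins `g ≡ 55` and `-g ≡ -55`
modulo `Nm(ℚ(√-3)ˣ)` (`g₁₂⁻¹·55 = 3·495²`, `g₁₃⁻¹·55 = 3·23760²`) and `[-g] ≠ split` by the cell's ALREADY-LANDED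
`sixfold_sqrtNeg3_neg55_ne_split` (`Ring2WeilCoverageNormTableC`, not restated).  Signature, admissibility, generation, LEMMA DG2 and
THEOREM X are computations / structure theorems of the census, not kernel facts; nothing here is a statement about Hodge classes;
`HC_CM` is used nowhere.

References: [cite: vanGeemen1994HodgeAV, 5.2 and (5.4.1)].
-/

noncomputable section

set_option linter.dupNamespace false

open Literature.AlgebraicGeometry.Motives
open Literature.AlgebraicGeometry.VanGeemen1994
open Summit.HodgeConjecture.HodgeConjecture.Ring2.Hypotheses
open Summit.HodgeConjecture.Ring2WeilNormDescent

namespace Summit.HodgeConjecture.HodgeConjecture.Ring2.WeilCoverage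

/-- **`(0; ω:3⁴, ω:3³2, ω:3³2)` in `C₃ × S₁₂` on the Specht module `S^{(10,2)}` (genus 239500801, (3,3) sixfold): the literal Gram determinant `g₁₂ = 1/13365` has class `[55]` in `ℚˣ/Nm(ℚ(√-3)ˣ)`: `g₁₂⁻¹·55 = 735075 = 0² + 3·495²`.**
research route conditional on HC_CM; not a corollary; Q11.4-sentence-2 already refuted in dim ≥ 3. [cite: vanGeemen1994HodgeAV, (5.4.1)] -/
theorem c3xS12_specht102_rigid_w3333_w3332_w3332_mk_gram_eq_fiftyFive :
    (QuotientGroup.mk (Units.mk0 ((1 : ℚ) / 13365) (by norm_num)) : weilNormResidueGroup 3) =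
      QuotientGroup.mk (Units.mk0 (55 : ℚ) (by norm_num)) := by
  rw [QuotientGroup.eq]
  have e : (Units.mk0 ((1 : ℚ) / 13365) (by norm_num))⁻¹ * Units.mk0 (55 : ℚ) (by norm_num) =
      Units.mk0 (735075 : ℚ) (by norm_num) := Units.ext (by norm_num)
  rw [e]
  exact mem_normUnitsSubgroup_of_sq_add_mul_sq _ (0 : ℚ) (495 : ℚ) (by norm_num)

/-- **… the `det H`-class: `-g₁₂ ≡ -55` modulo `Nm(ℚ(√-3)ˣ)`.**
research route conditional on HC_CM; not a corollary; Q11.4-sentence-2 already refuted in dim ≥ 3. [cite: vanGeemen1994HodgeAV, 5.2] -/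
theorem c3xS12_specht102_rigid_w3333_w3332_w3332_mk_negGram_eq_negFiftyFive :
    (QuotientGroup.mk (Units.mk0 ((-1 : ℚ) / 13365) (by norm_num)) : weilNormResidueGroup 3) =
      QuotientGroup.mk (Units.mk0 (-55 : ℚ) (by norm_num)) := by
  rw [QuotientGroup.eq]
  have e : (Units.mk0 ((-1 : ℚ) / 13365) (by norm_num))⁻¹ * Units.mk0 (-55 : ℚ) (by norm_num) =
      Units.mk0 (735075 : ℚ) (by norm_num) := Units.ext (by norm_num)
  rw [e]
  exact mem_normUnitsSubgroup_of_sq_add_mul_sq _ (0 : ℚ) (495 : ℚ) (by norm_num)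

/-- … hence `[-g₁₂]` is NOT the split class of `(3, ℚ(√-3))`: the hidden factor lies on the NON-split row W6.3.55 (the cell's `sixfold_sqrtNeg3_neg55_ne_split`, `Ring2WeilCoverageNormTableC`).
research route conditional on HC_CM; not a corollary; Q11.4-sentence-2 already refuted in dim ≥ 3. [cite: vanGeemen1994HodgeAV, (5.4.1)] -/
theorem c3xS12_specht102_rigid_w3333_w3332_w3332_mk_negGram_ne_split :
    (QuotientGroup.mk (Units.mk0 ((-1 : ℚ) / 13365) (by norm_num)) : weilNormResidueGroup 3) ≠
      splitDiscriminantClass 3 3 := by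
  rw [c3xS12_specht102_rigid_w3333_w3332_w3332_mk_negGram_eq_negFiftyFive]
  exact sixfold_sqrtNeg3_neg55_ne_split

/-- **`(0; -1:2⁵1², ω:3³2·1, ζ₆:6²)` in `C₆ × S₁₂` on the Specht module `S^{(10,2)}` (genus 239500801, (3,3) sixfold): the literal Gram determinant `g₁₃ = 1/30792960` has class `[55]` in `ℚˣ/Nm(ℚ(√-3)ˣ)`: `g₁₃⁻¹·55 = 1693612800 = 0² + 3·23760²`.**
research route conditional on HC_CM; not a corollary; Q11.4-sentence-2 already refuted in dim ≥ 3. [cite: vanGeemen1994HodgeAV, (5.4.1)] -/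
theorem c6xS12_specht102_rigid_m1_22222_w3332_z66_mk_gram_eq_fiftyFive :
    (QuotientGroup.mk (Units.mk0 ((1 : ℚ) / 30792960) (by norm_num)) : weilNormResidueGroup 3) =
      QuotientGroup.mk (Units.mk0 (55 : ℚ) (by norm_num)) := by
  rw [QuotientGroup.eq]
  have e : (Units.mk0 ((1 : ℚ) / 30792960) (by norm_num))⁻¹ * Units.mk0 (55 : ℚ) (by norm_num) =
      Units.mk0 (1693612800 : ℚ) (by norm_num) := Units.ext (by norm_num)
  rw [e]
  exact mem_normUnitsSubgroup_of_sq_add_mul_sq _ (0 : ℚ) (23760 : ℚ) (by norm_num)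

/-- **… the `det H`-class: `-g₁₃ ≡ -55` modulo `Nm(ℚ(√-3)ˣ)`.**
research route conditional on HC_CM; not a corollary; Q11.4-sentence-2 already refuted in dim ≥ 3. [cite: vanGeemen1994HodgeAV, 5.2] -/
theorem c6xS12_specht102_rigid_m1_22222_w3332_z66_mk_negGram_eq_negFiftyFive :
    (QuotientGroup.mk (Units.mk0 ((-1 : ℚ) / 30792960) (by norm_num)) : weilNormResidueGroup 3) =
      QuotientGroup.mk (Units.mk0 (-55 : ℚ) (by norm_num)) := by
  rw [QuotientGroup.eq]
  have e : (Units.mk0 ((-1 : ℚ) / 30792960) (by norm_num))⁻¹ * Units.mk0 (-55 : ℚ) (by norm_num) =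
      Units.mk0 (1693612800 : ℚ) (by norm_num) := Units.ext (by norm_num)
  rw [e]
  exact mem_normUnitsSubgroup_of_sq_add_mul_sq _ (0 : ℚ) (23760 : ℚ) (by norm_num)

/-- … hence `[-g₁₃]` is NOT the split class of `(3, ℚ(√-3))`: this hidden factor, too, lies on the NON-split row W6.3.55.
research route conditional on HC_CM; not a corollary; Q11.4-sentence-2 already refuted in dim ≥ 3. [cite: vanGeemen1994HodgeAV, (5.4.1)] -/
theorem c6xS12_specht102_rigid_m1_22222_w3332_z66_mk_negGram_ne_split :
    (QuotientGroup.mk (Units.mk0 ((-1 : ℚ) / 30792960) (by norm_num)) : weilNormResidueGroup 3) ≠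
      splitDiscriminantClass 3 3 := by
  rw [c6xS12_specht102_rigid_m1_22222_w3332_z66_mk_negGram_eq_negFiftyFive]
  exact sixfold_sqrtNeg3_neg55_ne_split

end Summit.HodgeConjecture.HodgeConjecture.Ring2.WeilCoverage

end
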